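import Literature.Algebra.Homology.GroupCohomologyIntResolution
import Literature.Algebra.Homology.GroupCohomologyFiniteType
import HarnessLib

/-!
# Type `FP_∞` over `ℤ` gives cohomology of finite type over every coefficient ring

Topic `Algebra/Homology`; namespace `Literature.Algebra.Homology`.  Theorems only; no definition,
no named fact, no instance, no `sorry`.  Joins `GroupCohomologyIntResolution` (consequences over
any `k` of a free resolution of finite type over `ℤ`, via restriction of scalars) to the
`IsCohFiniteTypeUpTo k G m` bookkeeping of `GroupCohomologyFiniteType` (finite generation (F) and
commutation with directed unions (U) up to a multiplier, with its finite-index / commensurability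
calculus):

* `exists_map_eq_zero_of_directed_int` — the injectivity half of (U) over `k` from a `ℤ`-resolution
  (`ResolutionComparison.exists_map_eq_zero_of_directed` for the restrictions of scalars, and the
  natural bijections `Hⁿ(G, A|_ℤ) ≅ Hⁿ(G, A)`);
* `isCohFiniteTypeUpTo_one_of_int_resolution` — **a group of type `FP_∞` over `ℤ` has cohomology
  of finite type, multiplier `1`, over every commutative ring `k`**.

This is the form in which the finiteness theorem for arithmetic groups is printed — over `ℤ`:
"a `ℤ[Γ]`-free resolution of finite type of the `ℤ[Γ]`-module `ℤ`" [BorelSerre1973, §11.1 (c)] —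
while its consumers ([Scholze2015, §V.4]) work over `ℤ_p`.

## References

* K. S. Brown, *Cohomology of Groups*, GTM 87 (1982), III.1 Example 3, VIII (4.6), (4.8),
  VIII.4 Ex. 1 [Brown1982CohomologyGroups].
* A. Borel, J.-P. Serre, *Corners and arithmetic groups* (1973), §11.1 (c) [BorelSerre1973].
* J.-P. Serre, *Cohomologie des groupes discrets* (1971), §1.8 [Serre1971CohomologieGroupesDiscrets].
-/

noncomputable section

open CategoryTheory groupCohomology

namespace Literature.Algebra.Homology

variable {k : Type} [CommRing k] {G : Type} [Group G]

/-- **`Hⁿ(G, -)` commutes with directed unions over `k` for `G` of type `FP_∞` over `ℤ`,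
injectivity half**: a class of `Hⁿ(G, A_i)` dying in `Hⁿ(G, B)` dies in some `Hⁿ(G, A_j)`.
[cite: Brown1982CohomologyGroups, VIII (4.6)] -/
theorem exists_map_eq_zero_of_directed_int {ι : Type*} [Preorder ι] [IsDirected ι (· ≤ ·)]
    [Nonempty ι] (P : ProjectiveResolution (Rep.trivial ℤ G ℤ))
    (hP : ∀ i, ∃ m : ℕ, Nonempty (P.complex.X i ≅ Rep.free ℤ G (Fin m)))
    {A : ι → Rep.{0} k G} {B : Rep.{0} k G} (φ : ∀ i, A i ⟶ B)
    (hinj : ∀ i, Function.Injective (φ i).hom)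
    (t : ∀ ⦃i j⦄, i ≤ j → (A i ⟶ A j)) (ht : ∀ ⦃i j⦄ (h : i ≤ j), t h ≫ φ j = φ i)
    (hcov : ∀ b : B, ∃ i, ∃ a : A i, (φ i).hom a = b) (n : ℕ) (i : ι)
    (y : groupCohomology (A i) n) (hy : map (MonoidHom.id G) (φ i) n y = 0) :
    ∃ j, ∃ h : i ≤ j, map (MonoidHom.id G) (t h) n y = 0 := by
  obtain ⟨y', rfl⟩ := (semimap_intRep_bijective (A i) n).2 y
  have hy' : map (MonoidHom.id G) (intRepMap (φ i)) n y' = 0 := by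
    apply (semimap_intRep_bijective B n).1
    rw [semimap_map (ofIntRep (A i)) (ofIntRep_equivariant (A i)) (ofIntRep B)
      (ofIntRep_equivariant B) (intRepMap (φ i)) (φ i) (fun a => rfl) n y', hy, map_zero]
  obtain ⟨j, hij, hj⟩ := ResolutionComparison.exists_map_eq_zero_of_directed P hP
    (A := fun i => intRep (A i)) (B := intRep B) (fun i => intRepMap (φ i))
    (fun i => by exact hinj i) (fun _ _ h => intRepMap (t h))
    (fun _ _ h => by rw [← intRepMap_comp, ht]) (fun b => by exact hcov b) n i y' hy'
  refine ⟨j, hij, ?_⟩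
  rw [← semimap_map (ofIntRep (A i)) (ofIntRep_equivariant (A i)) (ofIntRep (A j))
    (ofIntRep_equivariant (A j)) (intRepMap (t hij)) (t hij) (fun a => rfl) n y', hj, map_zero]

/-- **Type `FP_∞` over `ℤ` implies cohomology of finite type (multiplier `1`) over every
commutative ring `k`**: if the trivial `ℤ[G]`-module `ℤ` has a projective resolution with every
term isomorphic to a free `ℤ[G]`-module of finite rank, then `IsCohFiniteTypeUpTo k G 1` — (F)
`Hⁿ(G, A)` finitely generated for `A` finitely generated over Noetherian `k`
(`moduleFinite_groupCohomology_of_int_resolution`), (U) `Hⁿ(G, -)` commutes with directed unions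
of `k`-linear subrepresentations (`exists_map_eq_of_directed_int`,
`exists_map_eq_zero_of_directed_int`).
[cite: BorelSerre1973, §11.1 (c)] [cite: Brown1982CohomologyGroups, VIII (4.6), VIII.4 Ex. 1]
[cite: Serre1971CohomologieGroupesDiscrets, §1.8 Remarque] -/
theorem isCohFiniteTypeUpTo_one_of_int_resolution (P : ProjectiveResolution (Rep.trivial ℤ G ℤ))
    (hP : ∀ i, ∃ m : ℕ, Nonempty (P.complex.X i ≅ Rep.free ℤ G (Fin m))) :
    IsCohFiniteTypeUpTo k G 1 where
  moduleFinite A _ n := moduleFinite_groupCohomology_of_int_resolution P hP A n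
  exists_map_eq D n x := by
    obtain ⟨i, y, hy⟩ := exists_map_eq_of_directed_int P hP D.φ D.injective D.t D.t_comp
      D.exhaust n x
    exact ⟨i, y, by rw [hy, one_smul]⟩
  exists_map_eq_zero D n i y hy := by
    obtain ⟨j, hij, hj⟩ := exists_map_eq_zero_of_directed_int P hP D.φ D.injective D.t D.t_comp
      D.exhaust n i y hy
    exact ⟨j, hij, by rw [one_smul, hj]⟩

end Literature.Algebra.Homology
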